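import Summits.HubbardSuperconductivity.HubbardSuperconductivity.Theorems.SoloBlindSectorGibbsEntropy
import Summits.HubbardSuperconductivity.HubbardSuperconductivity.Theorems.SoloBlindPenaltyTransfer
import HarnessLib

/-!
# The price of an approximate penalised minimiser is its excess energy over the penalty

Solo programme `solo-HubbardSuperconductivity-blind`, structural Theorem 19 (the common core of
Theorems 17 and 18, and the primal form of a proof WITHOUT gap or covering conditions).
`A`, `O` Hermitian, `K` a subspace, `s > 0`, `B = A + s O`, `E₀(·) = minEnergyOn · K`.

* `groundState_re_rayleigh_ge_of_approx_penalised` — if a unit vector `χ ∈ K` has PENALISED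
  energy `re ⟨χ, B χ⟩ ≤ E₀(B) + ε` and order `re ⟨χ, O χ⟩ ≥ a`, then EVERY unit ground state `φ`
  of `A` on `K` has `re ⟨φ, O φ⟩ ≥ a - ε / s`
  (`E₀(A) + s a ≤ ⟨χ,Aχ⟩ + s⟨χ,Oχ⟩ = ⟨χ,Bχ⟩ ≤ E₀(B) + ε ≤ E₀(A) + s⟨φ,Oφ⟩ + ε`).
  Theorem 17 (`groundState_re_rayleigh_ge_of_penalised`) is the case `ε = 0`.
* `groundState_re_rayleigh_ge_of_sectorGibbs_penalised_energy` — the same for the canonical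
  sector Gibbs state of `B` at any `β`: if its energy is `≤ E₀(B) + ε` (times `Z_K`) and its order
  is `≥ a`, every ground state of `A` on `K` has order `≥ a - ε / s`. Theorem 18
  (`groundState_re_rayleigh_ge_of_sectorGibbs_penalised`) is the case `ε = log (dim K) / β`, the
  universal entropy bound (`re_trace_sectorGibbs_hamiltonian_le`); the price of a thermal route is
  the THERMAL EXCITATION ENERGY of the penalised model in the sector, of which the entropy bound is
  only the worst case.
* `hubbardSuperconductivity_iff_approx_penalised_state` — **the primal form of the summit without
  gap or covering conditions**: `HubbardSuperconductivity` holds iff for some `U > 0`,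
  `δ ∈ (0,1/2)`, `c > 0`, `L₀`, at every even side `L ≥ L₀` there are `s > 0` and ONE unit vector
  `χ` of the doped sector `K_L` with d-wave order `re ⟨χ, (√2Δ_d)†(√2Δ_d) χ⟩ ≥ c L⁴` whose energy
  for the PENALISED `H_L + s (√2Δ_d)†(√2Δ_d)` is within `s c L⁴ / 2` of that operator's sector
  ground energy. Compare Theorem 5 (`hubbardSuperconductivity_iff_closeTrialSubspaces`): trial
  SUBSPACES, energies within `η_L ≤ c γ_L / 1600` of the UNPENALISED ground energy (`γ_L` the sector
  gap, `O(|t|/L)`), and a covering condition; here ONE state, NO gap, NO covering. In the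
  necessity direction `χ` is a penalised sector ground state, for which the penalty ceiling
  `s c L⁴ ≤ 16π²⌈800/c⌉²|t|` of `SoloBlindPenaltyCeiling` (`penalty_le_of_dWave_groundState_order`)
  holds: so the equivalent statement may be taken with an `L`-INDEPENDENT energy tolerance
  `s c L⁴/2 = O(|t|/c²)`. What a constructive proof must supply is therefore a pair (trial state
  with order and a computable penalised energy, LOWER bound on the penalised sector ground energy)
  matching to `O(1)` in TOTAL energy; the order parameter enters only through the trial state.
* `hubbardSuperconductivity_of_penalised_thermal_energy` — the thermal version: ONE canonical
  sector Gibbs state of `H_L + s_L (√2Δ_d)†(√2Δ_d)` per side, at ANY `β_L`, with thermal excitation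
  energy `≤ s_L c L⁴ / 2` and order `≥ c L⁴`, gives the summit (constant `c/2`). Since order
  `c L⁴` survives only penalties `s_L = O(|t|/(c³L⁴))` (the symmetrised twist comparison;
  formalised for ground states in `SoloBlindPenaltyCeiling` and for the entropy-form hypothesis in
  `SoloBlindThermalPenaltyCeiling`, informal for the present hypothesis), this asks for an
  `L`-independent TOTAL thermal excitation energy `O(|t|/c²)` in the sector: `β_L` above the
  inverse of the temperature `T_L` at which `∫₀^{T_L} C_V dT = O(1)` (`T_L ≍ 1/L` for a
  Fermi-liquid specific heat `γ T L²`, `≍ L^{-2/3}` for the `T² L²` of nodal quasiparticle pairs and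
  two-dimensional phase phonons, `≍ 1/log L` for a full gap — physics, not proved here), in place
  of the entropy form's universal `β_L ≍ L²/|t|`.

Elementary (one variational inequality each way). [this work]
-/

noncomputable section

namespace Summit.HubbardSuperconductivity.HubbardSuperconductivity.Theorems

open Matrix Filter Topology Literature.Probability.LatticeModels
  Literature.MathematicalPhysics.QuantumLattice
  Literature.MathematicalPhysics.QuantumLattice.EigenvalueContinuation
open scoped ComplexOrder

/-! ### Abstract: approximate penalised minimisers -/

section Abstract

variable {n : Type*} [Fintype n] [DecidableEq n]

/-- **Theorem 19 (pure-state form).** `A`, `O` Hermitian, `K` a subspace, `s > 0`. A unit vector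
`χ ∈ K` with penalised energy `re ⟨χ, (A + sO) χ⟩ ≤ minEnergyOn (A + sO) K + ε` and
`a ≤ re ⟨χ, O χ⟩` forces `a - ε/s ≤ re ⟨φ, O φ⟩` on EVERY unit ground eigenvector `φ` of `A` on `K`.
[this work] -/
theorem groundState_re_rayleigh_ge_of_approx_penalised {A O : Matrix n n ℂ} (hA : A.IsHermitian)
    (hO : O.IsHermitian) (K : Submodule ℂ (n → ℂ)) {s : ℝ} (hs : 0 < s) {ε a : ℝ}
    {χ : n → ℂ} (hχK : χ ∈ K) (hχ1 : star χ ⬝ᵥ χ = 1)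
    (hχE : (star χ ⬝ᵥ (A + (s : ℂ) • O) *ᵥ χ).re ≤ (A + (s : ℂ) • O).minEnergyOn K + ε)
    (ha : a ≤ (star χ ⬝ᵥ O *ᵥ χ).re)
    {φ : n → ℂ} (hφK : φ ∈ K) (hφ1 : star φ ⬝ᵥ φ = 1)
    (hφA : A *ᵥ φ = ((A.minEnergyOn K : ℝ) : ℂ) • φ) :
    a - ε / s ≤ (star φ ⬝ᵥ O *ᵥ φ).re := by
  have hB : (A + (s : ℂ) • O).IsHermitian := isHermitian_add_ofReal_smul hA hO s
  -- `E₀(A + sO) ≤ ⟨φ, (A + sO) φ⟩ = E₀(A) + s re⟨φ, O φ⟩`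
  have h1 : (A + (s : ℂ) • O).minEnergyOn K ≤ A.minEnergyOn K + s * (star φ ⬝ᵥ O *ᵥ φ).re := by
    have h := minEnergyOn_le_rayleigh_of_mem hB K hφK hφ1
    rw [add_mulVec, smul_mulVec, dotProduct_add, dotProduct_smul, Complex.add_re, smul_eq_mul,
      Complex.re_ofReal_mul, hφA, dotProduct_smul, hφ1, smul_eq_mul, mul_one,
      Complex.ofReal_re] at h
    exact h
  -- `E₀(A) ≤ ⟨χ, A χ⟩`
  have h2 : A.minEnergyOn K ≤ (star χ ⬝ᵥ A *ᵥ χ).re := by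
    have h := minEnergyOn_mul_le_re_rayleigh hA K hχK
    rwa [hχ1, Complex.one_re, mul_one] at h
  have hsplit : (star χ ⬝ᵥ (A + (s : ℂ) • O) *ᵥ χ).re =
      (star χ ⬝ᵥ A *ᵥ χ).re + s * (star χ ⬝ᵥ O *ᵥ χ).re := by
    rw [add_mulVec, smul_mulVec, dotProduct_add, dotProduct_smul, Complex.add_re, smul_eq_mul,
      Complex.re_ofReal_mul]
  rw [hsplit] at hχE
  have h3 : s * a ≤ s * (star χ ⬝ᵥ O *ᵥ χ).re := mul_le_mul_of_nonneg_left ha hs.le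
  have h4 : s * a ≤ s * (star φ ⬝ᵥ O *ᵥ φ).re + ε := by linarith
  have h5 : s * (a - ε / s) ≤ s * (star φ ⬝ᵥ O *ᵥ φ).re := by
    have : s * (a - ε / s) = s * a - ε := by field_simp
    rw [this]
    linarith
  exact le_of_mul_le_mul_left h5 hs

/-- **Theorem 19 (thermal form): the price of a thermal route is the thermal excitation energy.**
`A`, `O` Hermitian leaving `K` invariant, `s > 0`, any `β`, `B = A + sO`, `P_K` the sector projector.
If the canonical sector Gibbs state of `B` has energy `re tr (P_K e^{-βB} B) ≤ (E₀(B) + ε) · Z_K`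
and order `a ≤ re ⟨O⟩_{K,β}`, then every unit ground eigenvector `φ` of `A` on `K` has
`a - ε/s ≤ re ⟨φ, O φ⟩`. With `ε = log (dim K)/β` (`re_trace_sectorGibbs_hamiltonian_le`) this is
Theorem 18. [this work] -/
theorem groundState_re_rayleigh_ge_of_sectorGibbs_penalised_energy {A O : Matrix n n ℂ}
    (hA : A.IsHermitian) (hO : O.IsHermitian) (K : Submodule ℂ (n → ℂ))
    (hKA : ∀ v ∈ K, A *ᵥ v ∈ K) (hKO : ∀ v ∈ K, O *ᵥ v ∈ K) {s : ℝ} (hs : 0 < s) (β : ℝ)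
    {ε a : ℝ}
    (hε : (projMatrix (Submodule.map ((WithLp.linearEquiv 2 ℂ (n → ℂ)).symm :
          (n → ℂ) →ₗ[ℂ] EuclideanSpace ℂ n) K) * gibbsWeight β (A + (s : ℂ) • O) *
          (A + (s : ℂ) • O)).trace.re ≤
        ((A + (s : ℂ) • O).minEnergyOn K + ε) *
          (projMatrix (Submodule.map ((WithLp.linearEquiv 2 ℂ (n → ℂ)).symm :
            (n → ℂ) →ₗ[ℂ] EuclideanSpace ℂ n) K) * gibbsWeight β (A + (s : ℂ) • O)).trace.re)
    (ha : a ≤ ((projMatrix (Submodule.map ((WithLp.linearEquiv 2 ℂ (n → ℂ)).symm :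
          (n → ℂ) →ₗ[ℂ] EuclideanSpace ℂ n) K) * gibbsWeight β (A + (s : ℂ) • O) * O).trace /
      (projMatrix (Submodule.map ((WithLp.linearEquiv 2 ℂ (n → ℂ)).symm :
          (n → ℂ) →ₗ[ℂ] EuclideanSpace ℂ n) K) * gibbsWeight β (A + (s : ℂ) • O)).trace).re)
    {φ : n → ℂ} (hφK : φ ∈ K) (hφ1 : star φ ⬝ᵥ φ = 1)
    (hφA : A *ᵥ φ = ((A.minEnergyOn K : ℝ) : ℂ) • φ) :
    a - ε / s ≤ (star φ ⬝ᵥ O *ᵥ φ).re := by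
  set P : Matrix n n ℂ := projMatrix (Submodule.map ((WithLp.linearEquiv 2 ℂ (n → ℂ)).symm :
    (n → ℂ) →ₗ[ℂ] EuclideanSpace ℂ n) K) with hP
  have hB : (A + (s : ℂ) • O).IsHermitian := isHermitian_add_ofReal_smul hA hO s
  have hinv : ∀ v ∈ K, (A + (s : ℂ) • O) *ᵥ v ∈ K := fun v hv => by
    rw [add_mulVec, smul_mulVec]
    exact K.add_mem (hKA v hv) (K.smul_mem _ (hKO v hv))
  have hK : K ≠ ⊥ := by
    rintro rfl
    rw [Submodule.mem_bot] at hφK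
    rw [hφK] at hφ1
    simp at hφ1
  have hZpos : 0 < (P * gibbsWeight β (A + (s : ℂ) • O)).trace.re :=
    re_trace_sectorGibbs_pos hB K hinv hK β
  -- (i) `A ≥ E₀(A)` on `K`, averaged
  have h1 : A.minEnergyOn K * (P * gibbsWeight β (A + (s : ℂ) • O)).trace.re ≤
      (P * gibbsWeight β (A + (s : ℂ) • O) * A).trace.re :=
    mul_re_trace_sectorGibbs_le hB K β hKA fun v hv => minEnergyOn_mul_le_re_rayleigh hA K hv
  -- (ii) linearity in the observable
  have h2 : (P * gibbsWeight β (A + (s : ℂ) • O) * (A + (s : ℂ) • O)).trace.re =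
      (P * gibbsWeight β (A + (s : ℂ) • O) * A).trace.re +
        s * (P * gibbsWeight β (A + (s : ℂ) • O) * O).trace.re := by
    rw [Matrix.mul_add, Matrix.mul_smul, trace_add, trace_smul, Complex.add_re, smul_eq_mul,
      Complex.re_ofReal_mul]
  -- (iii) `E₀(A + sO) ≤ ⟨φ, (A + sO) φ⟩ = E₀(A) + s re⟨φ, O φ⟩`
  have h4 : (A + (s : ℂ) • O).minEnergyOn K ≤ A.minEnergyOn K + s * (star φ ⬝ᵥ O *ᵥ φ).re := by
    have h := minEnergyOn_le_rayleigh_of_mem hB K hφK hφ1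
    rw [add_mulVec, smul_mulVec, dotProduct_add, dotProduct_smul, Complex.add_re, smul_eq_mul,
      Complex.re_ofReal_mul, hφA, dotProduct_smul, hφ1, smul_eq_mul, mul_one,
      Complex.ofReal_re] at h
    exact h
  have h5 : ((A + (s : ℂ) • O).minEnergyOn K + ε) * (P * gibbsWeight β (A + (s : ℂ) • O)).trace.re
      ≤ (A.minEnergyOn K + s * (star φ ⬝ᵥ O *ᵥ φ).re + ε) *
        (P * gibbsWeight β (A + (s : ℂ) • O)).trace.re :=
    mul_le_mul_of_nonneg_right (by linarith) hZpos.le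
  have hX : s * (P * gibbsWeight β (A + (s : ℂ) • O) * O).trace.re ≤
      (s * (star φ ⬝ᵥ O *ᵥ φ).re + ε) * (P * gibbsWeight β (A + (s : ℂ) • O)).trace.re := by
    nlinarith [h1, h2, hε, h5, hZpos]
  rw [re_sectorGibbs_div_eq hB K β O, le_div_iff₀ hZpos] at ha
  have h6 : s * a * (P * gibbsWeight β (A + (s : ℂ) • O)).trace.re ≤
      (s * (star φ ⬝ᵥ O *ᵥ φ).re + ε) * (P * gibbsWeight β (A + (s : ℂ) • O)).trace.re := by
    have h := mul_le_mul_of_nonneg_left ha hs.le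
    linarith
  have h7 : s * a ≤ s * (star φ ⬝ᵥ O *ᵥ φ).re + ε := le_of_mul_le_mul_right h6 hZpos
  have h8 : s * (a - ε / s) ≤ s * (star φ ⬝ᵥ O *ᵥ φ).re := by
    have : s * (a - ε / s) = s * a - ε := by field_simp
    rw [this]
    linarith
  exact le_of_mul_le_mul_left h8 hs

end Abstract

/-! ### The summit: one approximately optimal state of the penalised model per side -/

section Summit

/-- **Theorem 19 (Hubbard, primal form without gap or covering).** `HubbardSuperconductivity` holds
iff for some `U > 0`, `δ ∈ (0,1/2)`, `c > 0`, `L₀`, at every even side `L = n+1 ≥ L₀` there are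
`s > 0` and ONE unit vector `χ` of the doped sector `K = (2⌊(1-δ)L²/2⌋, S^z = 0)` with
`re ⟨χ, (H_L + sO_L) χ⟩ ≤ minEnergyOn (H_L + sO_L) K + s c L⁴ / 2` and `c L⁴ ≤ re ⟨χ, O_L χ⟩`,
`H_L = hubbardTorus 2 L 1 U`, `O_L = (√2Δ_d)†(√2Δ_d)`. Necessity: a penalised ground state
(Theorem 17, `penalised_groundState_order_of_hubbardSuperconductivity`; excess `0`). Sufficiency:
`groundState_re_rayleigh_ge_of_approx_penalised` and Theorem 1, constant `c/2`. [this work] -/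
theorem hubbardSuperconductivity_iff_approx_penalised_state :
    HubbardSuperconductivity ↔
      ∃ U : ℝ, 0 < U ∧ ∃ δ ∈ Set.Ioo (0 : ℝ) (1 / 2), ∃ c : ℝ, 0 < c ∧ ∃ L₀ : ℕ,
        ∀ n : ℕ, Even (n + 1) → L₀ ≤ n + 1 → ∃ s : ℝ, 0 < s ∧
          ∃ χ : Fock (Orb (FermionTorus 2 (n + 1))), star χ ⬝ᵥ χ = 1 ∧
            χ ∈ szSector (Λ := FermionTorus 2 (n + 1))
              (2 * ⌊(1 - δ) * ((n + 1 : ℕ) : ℝ) ^ 2 / 2⌋₊) 0 ∧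
            (star χ ⬝ᵥ (hubbardTorus 2 (n + 1) 1 U + (s : ℂ) •
                ((pairField dWaveFormFactor (n + 1))ᴴ * pairField dWaveFormFactor (n + 1))) *ᵥ
                  χ).re ≤
              (hubbardTorus 2 (n + 1) 1 U + (s : ℂ) •
                  ((pairField dWaveFormFactor (n + 1))ᴴ * pairField dWaveFormFactor (n + 1))
                ).minEnergyOn (szSector (Λ := FermionTorus 2 (n + 1))
                  (2 * ⌊(1 - δ) * ((n + 1 : ℕ) : ℝ) ^ 2 / 2⌋₊) 0) +
                s * c * ((n + 1 : ℕ) : ℝ) ^ 4 / 2 ∧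
            c * ((n + 1 : ℕ) : ℝ) ^ 4 ≤
              (expect ((pairField dWaveFormFactor (n + 1))ᴴ * pairField dWaveFormFactor (n + 1))
                χ).re := by
  constructor
  · intro hS
    obtain ⟨U, hU, δ, hδ, c, hc, L₀, hb⟩ := penalised_groundState_order_of_hubbardSuperconductivity hS
    refine ⟨U, hU, δ, hδ, c, hc, L₀, fun n hn hL => ?_⟩
    obtain ⟨s, hs, ⟨φ, hφ1, hφ⟩, hall⟩ := hb n hn hL
    refine ⟨s, hs, φ, hφ1, hφ.1, ?_, hall φ hφ1 hφ⟩
    rw [re_rayleigh_of_eigen_minEnergyOn hφ1 hφ.2.2]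
    have : 0 ≤ s * c * ((n + 1 : ℕ) : ℝ) ^ 4 / 2 := by positivity
    linarith
  · rintro ⟨U, hU, δ, hδ, c, hc, L₀, hb⟩
    refine hubbardSuperconductivity_of_uniform_dWave_bound
      ⟨U, hU, δ, hδ, c / 2, by positivity, L₀, fun n hn hL φ hφ1 hgs => ?_⟩
    obtain ⟨s, hs, χ, hχ1, hχK, hχE, hord⟩ := hb n hn hL
    set O := (pairField dWaveFormFactor (n + 1))ᴴ * pairField dWaveFormFactor (n + 1) with hO
    have h := groundState_re_rayleigh_ge_of_approx_penalised (isHermitian_hubbardTorus (n + 1) 1 U)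
      (isHermitian_conjTranspose_mul_self _) _ hs hχK hχ1 hχE hord hgs.1 hφ1 hgs.2.2
    have hε : s * c * ((n + 1 : ℕ) : ℝ) ^ 4 / 2 / s = c * ((n + 1 : ℕ) : ℝ) ^ 4 / 2 := by
      field_simp
    rw [hε] at h
    change c / 2 * ((n + 1 : ℕ) : ℝ) ^ 4 ≤ (star φ ⬝ᵥ (O *ᵥ φ)).re
    linarith

/-- **Theorem 19 (Hubbard, thermal form at an arbitrary temperature).** If for some `U > 0`,
`δ ∈ (0,1/2)`, `c > 0`, `L₀`, at every even side `L = n+1 ≥ L₀` there are `s > 0` and `β` such that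
the canonical Gibbs state of the doped sector `K` for the penalised `B_L = H_L + s (√2Δ_d)†(√2Δ_d)`
has thermal excitation energy `re tr (P_K e^{-βB_L} B_L) ≤ (minEnergyOn B_L K + s c L⁴/2) · Z_K`
and order `c L⁴ ≤ re (tr (P_K e^{-βB_L} O_L) / Z_K)`, then `HubbardSuperconductivity` (constant
`c/2`, every ground state of the unpenalised `H_L`). No gap, no uniqueness, no constraint tying
`β` to `L` other than the energy condition itself. [this work] -/
theorem hubbardSuperconductivity_of_penalised_thermal_energy
    (h : ∃ U : ℝ, 0 < U ∧ ∃ δ ∈ Set.Ioo (0 : ℝ) (1 / 2), ∃ c : ℝ, 0 < c ∧ ∃ L₀ : ℕ,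
      ∀ n : ℕ, Even (n + 1) → L₀ ≤ n + 1 → ∃ s : ℝ, 0 < s ∧ ∃ β : ℝ,
        (projMatrix ((szSector (Λ := FermionTorus 2 (n + 1))
              (2 * ⌊(1 - δ) * ((n + 1 : ℕ) : ℝ) ^ 2 / 2⌋₊) 0).map
              ((WithLp.linearEquiv 2 ℂ (Fock (Orb (FermionTorus 2 (n + 1))))).symm :
                Fock (Orb (FermionTorus 2 (n + 1))) →ₗ[ℂ]
                  EuclideanSpace ℂ (Finset (Orb (FermionTorus 2 (n + 1)))))) *
            gibbsWeight β (hubbardTorus 2 (n + 1) 1 U + (s : ℂ) •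
              ((pairField dWaveFormFactor (n + 1))ᴴ * pairField dWaveFormFactor (n + 1))) *
            (hubbardTorus 2 (n + 1) 1 U + (s : ℂ) •
              ((pairField dWaveFormFactor (n + 1))ᴴ * pairField dWaveFormFactor (n + 1)))
          ).trace.re ≤
          ((hubbardTorus 2 (n + 1) 1 U + (s : ℂ) •
              ((pairField dWaveFormFactor (n + 1))ᴴ * pairField dWaveFormFactor (n + 1))
              ).minEnergyOn (szSector (Λ := FermionTorus 2 (n + 1))
                (2 * ⌊(1 - δ) * ((n + 1 : ℕ) : ℝ) ^ 2 / 2⌋₊) 0) +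
            s * c * ((n + 1 : ℕ) : ℝ) ^ 4 / 2) *
          (projMatrix ((szSector (Λ := FermionTorus 2 (n + 1))
              (2 * ⌊(1 - δ) * ((n + 1 : ℕ) : ℝ) ^ 2 / 2⌋₊) 0).map
              ((WithLp.linearEquiv 2 ℂ (Fock (Orb (FermionTorus 2 (n + 1))))).symm :
                Fock (Orb (FermionTorus 2 (n + 1))) →ₗ[ℂ]
                  EuclideanSpace ℂ (Finset (Orb (FermionTorus 2 (n + 1)))))) *
            gibbsWeight β (hubbardTorus 2 (n + 1) 1 U + (s : ℂ) •
              ((pairField dWaveFormFactor (n + 1))ᴴ * pairField dWaveFormFactor (n + 1)))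
          ).trace.re ∧
        c * ((n + 1 : ℕ) : ℝ) ^ 4 ≤
          ((projMatrix ((szSector (Λ := FermionTorus 2 (n + 1))
                (2 * ⌊(1 - δ) * ((n + 1 : ℕ) : ℝ) ^ 2 / 2⌋₊) 0).map
                ((WithLp.linearEquiv 2 ℂ (Fock (Orb (FermionTorus 2 (n + 1))))).symm :
                  Fock (Orb (FermionTorus 2 (n + 1))) →ₗ[ℂ]
                    EuclideanSpace ℂ (Finset (Orb (FermionTorus 2 (n + 1)))))) *
              gibbsWeight β (hubbardTorus 2 (n + 1) 1 U + (s : ℂ) •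
                ((pairField dWaveFormFactor (n + 1))ᴴ * pairField dWaveFormFactor (n + 1))) *
              ((pairField dWaveFormFactor (n + 1))ᴴ * pairField dWaveFormFactor (n + 1))).trace /
            (projMatrix ((szSector (Λ := FermionTorus 2 (n + 1))
                (2 * ⌊(1 - δ) * ((n + 1 : ℕ) : ℝ) ^ 2 / 2⌋₊) 0).map
                ((WithLp.linearEquiv 2 ℂ (Fock (Orb (FermionTorus 2 (n + 1))))).symm :
                  Fock (Orb (FermionTorus 2 (n + 1))) →ₗ[ℂ]
                    EuclideanSpace ℂ (Finset (Orb (FermionTorus 2 (n + 1)))))) *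
              gibbsWeight β (hubbardTorus 2 (n + 1) 1 U + (s : ℂ) •
                ((pairField dWaveFormFactor (n + 1))ᴴ *
                  pairField dWaveFormFactor (n + 1)))).trace).re) :
    HubbardSuperconductivity := by
  obtain ⟨U, hU, δ, hδ, c, hc, L₀, hb⟩ := h
  refine hubbardSuperconductivity_of_uniform_dWave_bound
    ⟨U, hU, δ, hδ, c / 2, by positivity, L₀, fun n hn hL φ hφ1 hgs => ?_⟩
  obtain ⟨s, hs, β, hε, hth⟩ := hb n hn hL
  obtain ⟨hN2, hKne⟩ := dopedSector_two_le_and_ne_bot U hδ hn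
  set N : ℕ := 2 * ⌊(1 - δ) * ((n + 1 : ℕ) : ℝ) ^ 2 / 2⌋₊ with hN
  set K : Submodule ℂ (Fock (Orb (FermionTorus 2 (n + 1)))) := szSector N 0 with hK
  set H := hubbardTorus 2 (n + 1) 1 U with hH
  set O := (pairField dWaveFormFactor (n + 1))ᴴ * pairField dWaveFormFactor (n + 1) with hO
  have hKA : ∀ v ∈ K, H *ᵥ v ∈ K := fun v hv => hubbardTorus_mulVec_mem_szSector 1 U hv
  have hKO : ∀ v ∈ K, O *ᵥ v ∈ K := by
    intro v hv
    rw [hO, ← mulVec_mulVec]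
    have h := PairTower.pairField_conjTranspose_mulVec_mem_szSector dWaveFormFactor
      (PairTower.pairField_mulVec_mem_szSector dWaveFormFactor hv)
    rwa [Nat.sub_add_cancel hN2] at h
  have hφ := groundState_re_rayleigh_ge_of_sectorGibbs_penalised_energy
    (isHermitian_hubbardTorus (n + 1) 1 U) (isHermitian_conjTranspose_mul_self _) K hKA hKO hs β
    hε hth hgs.1 hφ1 hgs.2.2
  have hε' : s * c * ((n + 1 : ℕ) : ℝ) ^ 4 / 2 / s = c * ((n + 1 : ℕ) : ℝ) ^ 4 / 2 := by
    field_simp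
  rw [hε'] at hφ
  change c / 2 * ((n + 1 : ℕ) : ℝ) ^ 4 ≤ (star φ ⬝ᵥ (O *ᵥ φ)).re
  linarith

end Summit

end Summit.HubbardSuperconductivity.HubbardSuperconductivity.Theorems

end
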